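import Summits.MatrixMultiplication.OmegaCensus.SmallFormats.MatMulM22Length3m3Dichotomy
import HarnessLib

/-!
# ω-census family (a): Alekseev frames at length `3m + 3`, part 2 — the parameters `(2m, m+3)` are impossible for `m ≥ 8` (any field)

Cell `pub-omega` (unit `pub-omega-tensor`, gen 38), topic `Summits/MatrixMultiplication/OmegaCensus` (sub-folder
`SmallFormats`). Framing (verbatim): lottery ticket; floor = certified bounds/negative ranges. HONEST FRAMING: a structural
theorem about bilinear algorithms for `⟨m,2,2⟩` (equivalently `⟨2,2,m⟩`) of length `3m + 3` over an ARBITRARY field, one step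
beyond the printed frame analysis (Alekseev 2015, Lemma 7: no solution of Problem `P` with parameters `(2m, m+2)`, `m ≥ 5`;
tree: `Alekseev2015.Frame.stepD_two`, p703299). NEW mathematics of the cell, not a cited result; NOT a bound on any rank by
itself; nothing here is a bound on `ω`. Part 1 (`MatMulM22Length3m3Dichotomy.lean`) proves Lemma 11 at `(2m, ≤ m+3)`,
`m ≥ 8` (`Frame3m3.false_of_sameClass_three`); this part concludes.

* `Frame3m3.stepD_three` — **no frame with `|I| = 2m` and `|J| ≤ m + 3`, `m ≥ 8`** (Alekseev's Lemma 7 skeleton: `s ≤ 6`, a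
  non-zero `Q = ∑ c_i P_i` in the span of the rank-two `N_t` exists since `m − 6 ≥ 1`, and it forces a rank-two `N_t` to have
  rank one).
* `Frame3m3.two_mul_add_one_le_card_I`, `Frame3m3.card_J_le` — a computation of length `≤ 3m + 3`, `m ≥ 8`, has `|I| ≥ 2m + 1` and
  `|J| ≤ m + 2` for EVERY frame; `Frame3m3.params_of_card_eq` — at length exactly `3m + 3` the parameters are `(2m+1, m+2)`,
  `(2m+2, m+1)` or `(2m+3, m)`.
* Census form (`FramePlaneCap.card_le_four_of_*_3m3`): in a length-`(3m+3)` computation of `⟨2,2,m⟩`, `m ≥ 8`, at most FOUR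
  X-forms have coefficient matrix in any given rank-one row/column plane (the old cap was `2d − 6m = 6`), via p714035
  `FramePlaneCap.card_le_of_frame_bound`. Over `𝔽₃` this sharpens the rows/columns clauses of the class-count systems at
  `(8,27)`, `(9,30)`, …; by kit GO #146 (tensor g37) cap `4` alone does not make those systems infeasible — the cap `2` would need
  the companion exclusion of `(2m+1, m+2)`-frames with three type-F indices, which is NOT proved here.

Calibration (desk, tensor g38 `desk/frameprobe.py`): the excluded parameters DO occur at `m = 5, 6` (Hopcroft–Kerr's
`⟨2,2,5⟩:18 = 3·5+3` has `(2m, m+3)` frames with six type-F indices; three Strassen blocks give the same at `(6, 21)`), so the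
hypothesis `m ≥ 8` is used essentially.
-/

namespace Summit.MatrixMultiplication.OmegaCensus.SmallFormats

open Finset Matrix Module
open Literature.Computability.AlgebraicComplexity
open Literature.Computability.AlgebraicComplexity.Alekseev2015

namespace Frame3m3

variable {k : Type*} [Field k] {m : ℕ} {ι : Type*} [Fintype ι] [DecidableEq ι]
variable {β : BilinComp (mulBilin k m 2 2) ι} (F : Frame β) (hI : F.I.card = 2 * m)

include hI in
/-- **No frame with parameters `(2m, ≤ m+3)` for `m ≥ 8`** (Alekseev's Lemma 7 skeleton one step further): the count of
rank-one `N_t` gives `s ≤ 6`; since `m − s ≥ 1` a non-zero `Q = ∑ c_i P_i` in the span of the rank-two `N_t` exists; writing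
`Q = ∑ λ_t N_t^2`, an index `t₀` with `λ_{t₀} ≠ 0` has all `N_{t₀}^2(x_j)` on the line `k p_{t₀}` (the other rank-two `N_t`
vanish on the class of `t₀` by Lemma 10 and `false_of_sameClass_three`, and `Q(x_j) ∈ k p_j` by Lemma 8), so `N_{t₀}^2` has
rank one — a contradiction. -/
theorem stepD_three (hm : 8 ≤ m) (hJ : F.J.card ≤ m + 3) : False := by
  classical
  have hR1 : F.R1.card ≤ 6 := card_R1_le_six F hJ
  -- the spaces
  let R2 : Finset ι := F.J \ F.R1
  let SS : Submodule k (Blk k m) := Submodule.span k (Set.range (rowMap k m))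
  let C : Submodule k (Blk k m) := Submodule.span k (Set.range fun t : ↥R2 => F.N2 t)
  let B1 : Submodule k (Blk k m) := Submodule.span k (↑(F.R1.image F.N2) : Set (Blk k m))
  have hSS : finrank k SS = m := by
    simp only [SS]
    rw [finrank_span_eq_card (linearIndependent_rowMap (k := k) (m := m)), Fintype.card_fin]
  have hB1 : finrank k B1 ≤ 6 :=
    ((finrank_span_finset_le_card (R := k) (F.R1.image F.N2)).trans Finset.card_image_le).trans hR1
  have hle : SS ≤ B1 ⊔ C := by
    refine Submodule.span_le.mpr ?_
    rintro _ ⟨i, rfl⟩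
    rw [F.rowMap_eq_sum_N2 i]
    refine Submodule.sum_mem _ fun t ht => Submodule.smul_mem _ _ ?_
    by_cases hR : t ∈ F.R1
    · refine Submodule.mem_sup_left (Submodule.subset_span ?_)
      rw [Finset.coe_image]
      exact ⟨t, by simpa using hR, rfl⟩
    · refine Submodule.mem_sup_right (Submodule.subset_span ?_)
      exact ⟨⟨t, Finset.mem_sdiff.2 ⟨ht, hR⟩⟩, rfl⟩
  have hdim : m ≤ finrank k ↥(SS ⊓ C) + 6 := by
    have h1 := Submodule.finrank_sup_add_finrank_inf_eq SS C
    have h2 : finrank k ↥(SS ⊔ C) ≤ finrank k ↥(B1 ⊔ C) :=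
      Submodule.finrank_mono (sup_le hle le_sup_right)
    have h3 := Submodule.finrank_add_le_finrank_add_finrank B1 C
    omega
  have hne : SS ⊓ C ≠ ⊥ := by
    intro hbot
    rw [hbot, finrank_bot] at hdim
    omega
  obtain ⟨Q, hQmem, hQne⟩ := Submodule.exists_mem_ne_zero_of_ne_bot hne
  obtain ⟨c, hc⟩ := (Submodule.mem_span_range_iff_exists_fun k).1 (Submodule.mem_inf.1 hQmem).1
  obtain ⟨lam, hlam⟩ := (Submodule.mem_span_range_iff_exists_fun k).1 (Submodule.mem_inf.1 hQmem).2
  -- a t0 with λ ≠ 0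
  obtain ⟨t0, ht0⟩ : ∃ t0 : ↥R2, lam t0 ≠ 0 := by
    by_contra hall
    apply hQne
    rw [← hlam]
    refine Finset.sum_eq_zero fun t _ => ?_
    rw [show lam t = 0 from not_not.mp (fun h => hall ⟨t, h⟩), zero_smul]
  have hR2J : ∀ t : ↥R2, (t : ι) ∈ F.J := fun t => (Finset.mem_sdiff.1 t.2).1
  have hR2I : ∀ t : ↥R2, (t : ι) ∉ F.I := fun t => F.mem_J.1 (hR2J t)
  have hR2R : ∀ t : ↥R2, (t : ι) ∉ F.R1 := fun t => (Finset.mem_sdiff.1 t.2).2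
  have hR2p : ∀ t : ↥R2, pvec β t ≠ 0 := fun t => F.pvec_ne_zero_of_not_mem_R1 (hR2J t) (hR2R t)
  -- all values N2 t0 (x_j) lie on the line k p_{t0}
  have hlineJ : ∀ j : ↥F.I, F.N2 t0 (F.xd hI j) ∈
      Submodule.span k ({pvec β t0} : Set (Fin 2 → k)) := by
    intro j
    by_cases hpar : ∃ a : k, pvec β j = a • pvec β t0
    · -- the other rank-two N_t vanish at x_j
      have hvan : ∀ t : ↥R2, t ≠ t0 → F.N2 t (F.xd hI j) = 0 := by
        intro t htne
        by_contra hne0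
        obtain ⟨a, ha⟩ := F.par_of_N2_xd_ne_zero hI (hR2I t) (hR2p t) j hne0
        obtain ⟨a', ha'⟩ := hpar
        have hane : a ≠ 0 := by
          rintro rfl; exact F.pvec_ne_zero j.2 (by rw [ha, zero_smul])
        refine false_of_sameClass_three F hI hm hJ (hR2J t0) (hR2J t)
          (fun h => htne (Subtype.ext h.symm)) (hR2R t0) (hR2R t) ⟨a⁻¹ * a', ?_⟩
        rw [mul_smul, ← ha', ha, smul_smul, inv_mul_cancel₀ hane, one_smul]
      have hQj : Q (F.xd hI j) = lam t0 • F.N2 t0 (F.xd hI j) := by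
        rw [← hlam, LinearMap.coe_sum, Finset.sum_apply, Finset.sum_eq_single t0]
        · rfl
        · intro t _ htne
          rw [LinearMap.smul_apply, hvan t htne, smul_zero]
        · simp
      have hQj' : Q (F.xd hI j) = (∑ i, c i * F.κ i j) • pvec β j := by
        rw [← hc, F.sum_rowMap_xd hI c j]
      obtain ⟨a', ha'⟩ := hpar
      have : F.N2 t0 (F.xd hI j) = ((lam t0)⁻¹ * ((∑ i, c i * F.κ i j) * a')) • pvec β t0 := by
        rw [mul_smul, ← smul_smul, ← ha', ← hQj', hQj, smul_smul, inv_mul_cancel₀ ht0, one_smul]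
      rw [this]
      exact Submodule.smul_mem _ _ (Submodule.mem_span_singleton_self _)
    · have : F.N2 t0 (F.xd hI j) = 0 := by
        by_contra hne0
        exact hpar (F.par_of_N2_xd_ne_zero hI (hR2I t0) (hR2p t0) j hne0)
      rw [this]
      exact Submodule.zero_mem _
  have hrk : RankLEOne (F.N2 t0) :=
    rankLEOne_of_forall_mem_span _ _ (map_mem_of_xd_mem₃ F hI _ _ hlineJ)
  exact hR2R t0 (F.mem_R1.2 ⟨hR2J t0, hrk⟩)

omit hI

/-- **Length `≤ 3m + 3`, `m ≥ 8`: every frame has `|I| ≥ 2m + 1`** (Lemma 6: `|I| ≥ 2m`, `|J| ≥ m`; `stepD_three`: `|I| ≠ 2m`). -/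
theorem two_mul_add_one_le_card_I (hm : 8 ≤ m) (hι : Fintype.card ι ≤ 3 * m + 3) :
    2 * m + 1 ≤ F.I.card := by
  have h1 := F.two_mul_le_card
  have h2 := F.le_card_J
  have h3 := F.card_I_add_card_J
  by_cases hI : F.I.card = 2 * m
  · exact (stepD_three F hI hm (by omega)).elim
  · omega

/-- **Length `≤ 3m + 3`, `m ≥ 8`: every frame has `|J| ≤ m + 2`.** -/
theorem card_J_le (hm : 8 ≤ m) (hι : Fintype.card ι ≤ 3 * m + 3) : F.J.card ≤ m + 2 := by
  have h1 := two_mul_add_one_le_card_I F hm hι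
  have h3 := F.card_I_add_card_J
  omega

/-- **The parameters of a length-`(3m + 3)` solution, `m ≥ 8`**: `(|I|, |J|) ∈ {(2m+1, m+2), (2m+2, m+1), (2m+3, m)}`. -/
theorem params_of_card_eq (hm : 8 ≤ m) (hι : Fintype.card ι = 3 * m + 3) :
    (F.I.card = 2 * m + 1 ∧ F.J.card = m + 2) ∨ (F.I.card = 2 * m + 2 ∧ F.J.card = m + 1) ∨
      (F.I.card = 2 * m + 3 ∧ F.J.card = m) := by
  have h1 := two_mul_add_one_le_card_I F hm hι.le
  have h2 := F.le_card_J
  have h3 := F.card_I_add_card_J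
  omega

end Frame3m3

/-! ## Census form: the rows/columns cap `4` at length `3m + 3`, `m ≥ 8` (any field) -/

namespace FramePlaneCap

open Summit.MatrixMultiplication.OmegaCensus.RankOnePlaneCapGeneral

variable {k : Type*} [Field k] {ι : Type*} [Fintype ι]

/-- An invertible `2 × 2` matrix with prescribed nonzero first row (copy of the private helper of `MatMul225FramePlaneCap`). -/
private theorem exists_det_ne_zero_row₃ (lam : Fin 2 → k) (hlam : lam ≠ 0) :
    ∃ P : Matrix (Fin 2) (Fin 2) k, P.det ≠ 0 ∧ ∀ d, P 0 d = lam d := by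
  by_cases h0 : lam 0 = 0
  · have h1 : lam 1 ≠ 0 := by
      intro h1; apply hlam; funext j; fin_cases j <;> simp [h0, h1]
    refine ⟨!![lam 0, lam 1; 1, 0], ?_, fun d => by fin_cases d <;> rfl⟩
    rw [Matrix.det_fin_two_of]; simpa [h0] using h1
  · refine ⟨!![lam 0, lam 1; 0, 1], ?_, fun d => by fin_cases d <;> rfl⟩
    rw [Matrix.det_fin_two_of]; simpa using h0

/-- **The base clause at length `3m + 3`, `m ≥ 8` (any field): at most FOUR X-forms of a length-`(3m+3)` computation of
`⟨2,2,m⟩` have coefficient matrix with zero first row** (`|J| ≤ m + 2` for every frame of the transposed computation,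
`Frame3m3.card_J_le`, fed to `card_le_of_frame_bound` with `j = 2`). -/
theorem card_le_four_of_row_zero_3m3 {m : ℕ} (hm : 8 ≤ m) (β : BilinComp (mulBilin k 2 2 m) ι)
    (hι : Fintype.card ι = 3 * m + 3) (s : Finset ι) (hs : ∀ t ∈ s, ∀ j, xMarginal β t 0 j = 0) : s.card ≤ 4 := by
  classical
  have h := card_le_of_frame_bound (j := 2) β hι (fun β' F hd => Frame3m3.card_J_le F hm hd.le) s hs
  omega

/-- **The ROW clause at length `3m + 3`, `m ≥ 8` (any field, every direction)**: `#{i : λᵀ U_i = 0} ≤ 4`. -/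
theorem card_le_four_of_vecMul_eq_zero_3m3 {m : ℕ} (hm : 8 ≤ m) (β : BilinComp (mulBilin k 2 2 m) ι)
    (hι : Fintype.card ι = 3 * m + 3) (lam : Fin 2 → k) (hlam : lam ≠ 0) (s : Finset ι)
    (hs : ∀ i ∈ s, Matrix.vecMul lam (xMarginal β i) = 0) : s.card ≤ 4 := by
  classical
  obtain ⟨P, hP, hrow⟩ := exists_det_ne_zero_row₃ lam hlam
  obtain ⟨β', hβ'⟩ := exists_xMarginal_eq_sandwich β P 1 hP (by simp)
  refine card_le_four_of_row_zero_3m3 hm β' hι s fun i hi j => ?_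
  have key : (P * xMarginal β i) 0 j = Matrix.vecMul lam (xMarginal β i) j := by
    simp only [Matrix.mul_apply, Matrix.vecMul, dotProduct, hrow]
  rw [hβ', Matrix.mul_one, key, hs i hi]
  rfl

/-- **The COLUMN clause at length `3m + 3`, `m ≥ 8` (any field, every direction)**: `#{i : U_i λ = 0} ≤ 4`. -/
theorem card_le_four_of_mulVec_eq_zero_3m3 {m : ℕ} (hm : 8 ≤ m) (β : BilinComp (mulBilin k 2 2 m) ι)
    (hι : Fintype.card ι = 3 * m + 3) (lam : Fin 2 → k) (hlam : lam ≠ 0) (s : Finset ι)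
    (hs : ∀ i ∈ s, Matrix.mulVec (xMarginal β i) lam = 0) : s.card ≤ 4 := by
  classical
  obtain ⟨β', hβ'⟩ := exists_xMarginal_eq_transpose β
  refine card_le_four_of_vecMul_eq_zero_3m3 hm β' hι lam hlam s fun i hi => ?_
  rw [hβ', Matrix.vecMul_transpose, hs i hi]

end FramePlaneCap

end Summit.MatrixMultiplication.OmegaCensus.SmallFormats
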